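import Mathlib.RingTheory.Norm.Transitivity
import Mathlib.RingTheory.Complex
import Literature.NumberTheory.Transcendental.FormIntegrationAddProofs
import Literature.Geometry.Kaehler.KaehlerProofs
import HarnessLib

/-!
# Positivity of the integral of a non-negative top form; the complex orientation

Two complements to the integration theory of top forms (`FormIntegration`,
`FormIntegrationCharts`, `FormIntegrationAddProofs`):

* `MForm.integral_pos_of_sign_mul_apply_nonneg` — on a compact boundaryless oriented manifold,
  a smooth top form which is non-negative with respect to the orientation at every point
  (`0 ≤ sign(o_x(e)) · α_x(e)` on the reference frame `e = modelBasis E n`, an intrinsic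
  condition) and positive at one point has positive integral (Lee (2013), Prop. 16.6 (c)): every
  chart integrand of `MForm.integral` is `|det| · ρᵢ · (sign · α) ≥ 0`, and the one of a chart
  carrying the positive point is positive on an open set.
* the **complex orientation**: on a complex manifold (holomorphic atlas on the complex model
  space `E`) the tangent coordinate changes are `ℂ`-linear, so their real determinants are
  `|det_ℂ|² > 0` (`det_tangentCoordChange_pos`, via `LinearMap.det_restrictScalars` and
  `Algebra.norm_complex_apply`); hence ANY constant orientation family `x ↦ o₀` is continuous
  (`isContinuousOrientation_const`) and its chart signs are the constant
  `sign (o₀.someVector (modelBasis E n)) ≠ 0` on every chart target (`chartSign_const_eq`).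
  (Huybrechts (2005), Cor. 1.2.3 / Lemma 1.2.9: complex manifolds are canonically oriented.)

## References

* J. M. Lee, *Introduction to Smooth Manifolds* (2013), Prop. 15.6, Prop. 16.6.
* D. Huybrechts, *Complex Geometry* (2005), Cor. 1.2.3, Lemma 1.2.9.
-/

noncomputable section

open scoped Manifold ContDiff Topology
open Set MeasureTheory Module Literature.Geometry.Kaehler

namespace Literature.NumberTheory.Transcendental

/-! ### Positivity of the integral -/

section Positivity

variable {E : Type*} [NormedAddCommGroup E] [NormedSpace ℝ E] [FiniteDimensional ℝ E]
  {n : ℕ} [Fact (finrank ℝ E = n)]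
  {H : Type*} [TopologicalSpace H] {I : ModelWithCorners ℝ E H}
  {M : Type*} [TopologicalSpace M] [ChartedSpace H M] [IsManifold I ∞ M]
  {o : (x : M) → Orientation ℝ (TangentSpace I x) (Fin n)}
  [MeasurableSpace E] [BorelSpace E] [T2Space M] [CompactSpace M] [I.Boundaryless]

omit [MeasurableSpace E] [BorelSpace E] [I.Boundaryless] in
/-- The chart integrand of `∫_M α` at the chart point of `x ∈ source`, factored:
`chartSign · ρᵢ · α̂ᵢ(e) = |det T| · ρᵢ(x) · (sign(o_x(e)) · α_x(e))`, `T` the tangent coordinate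
change from the chart at `i` to the chart at `x`. [cite: LeeSmoothManifolds2013, Prop. 16.6] -/
theorem chartIntegrand_extChartAt {α : MForm I M ℝ n} {i x : M} (hx : x ∈ (extChartAt I i).source) :
    chartSign o i (extChartAt I i x) * chartPartitionOfUnity I M i ((extChartAt I i).symm (extChartAt I i x)) *
        α.inChart i (extChartAt I i x) (modelBasis E n) =
      |LinearMap.det (tangentCoordChange I i x x : E →ₗ[ℝ] E)| * chartPartitionOfUnity I M i x *
        (Real.sign (orientationForm o x (modelBasis E n)) *
          (show E [⋀^Fin n]→L[ℝ] ℝ from α x) (modelBasis E n)) := by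
  rw [chartSign_extChartAt o hx, (extChartAt I i).left_inv hx]
  have h1 : α.inChart i (extChartAt I i x) (modelBasis E n) =
      LinearMap.det (tangentCoordChange I i x x : E →ₗ[ℝ] E) *
        (show E [⋀^Fin n]→L[ℝ] ℝ from α x) (modelBasis E n) := by
    rw [MForm.inChart_apply_extChartAt α hx]
    exact ContinuousAlternatingMap.apply_comp_eq_det_mul (modelBasis E n) _ _ _
  rw [h1, ← real_sign_mul_self]
  ring

/-- **Positivity of the integral of a non-negative, somewhere positive smooth top form** on a
compact boundaryless oriented manifold (Lee (2013), Prop. 16.6 (c), "if `ω` is positively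
oriented, `∫_M ω > 0`"): non-negativity and positivity are measured intrinsically by the sign of
`sign(o_x(e₁,…,eₙ)) · α_x(e₁,…,eₙ)` on the reference frame of the chart at `x`.
[cite: LeeSmoothManifolds2013, Prop. 16.6] -/
theorem _root_.Literature.Geometry.Kaehler.MForm.integral_pos_of_sign_mul_apply_nonneg
    (ho : IsContinuousOrientation o) {α : MForm I M ℝ n} (hα : IsSmoothForm α)
    (h0 : ∀ x : M, 0 ≤ Real.sign (orientationForm o x (modelBasis E n)) *
      (show E [⋀^Fin n]→L[ℝ] ℝ from α x) (modelBasis E n))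
    (h1 : ∃ x : M, 0 < Real.sign (orientationForm o x (modelBasis E n)) *
      (show E [⋀^Fin n]→L[ℝ] ℝ from α x) (modelBasis E n)) :
    0 < α.integral o := by
  classical
  obtain ⟨x₀, hx₀⟩ := h1
  set ρ := chartPartitionOfUnity I M with hρ
  set μ : Measure E := (modelBasis E n).addHaar with hμ
  set f : M → E → ℝ := fun i y ↦ chartSign o i y * ρ i ((extChartAt I i).symm y) *
    α.inChart i y (modelBasis E n) with hf
  set T : M → ℝ := fun i ↦ ∫ y in (extChartAt I i).target, f i y ∂μ with hT
  have hint : α.integral o = ∑ᶠ i, T i := rfl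
  -- the integrands are non-negative on the chart targets
  have hnonneg : ∀ i, ∀ y ∈ (extChartAt I i).target, 0 ≤ f i y := by
    intro i y hy
    have hx : (extChartAt I i).symm y ∈ (extChartAt I i).source := (extChartAt I i).map_target hy
    have hy' : y = extChartAt I i ((extChartAt I i).symm y) := ((extChartAt I i).right_inv hy).symm
    rw [hf]
    dsimp only
    rw [hy', chartIntegrand_extChartAt hx]
    exact mul_nonneg (mul_nonneg (abs_nonneg _) (ρ.nonneg i _)) (h0 _)
  have hTnonneg : ∀ i, 0 ≤ T i := fun i ↦
    setIntegral_nonneg (measurableSet_extChartAt_target i) (hnonneg i)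
  -- a chart carrying `x₀`
  obtain ⟨i₀, hi₀⟩ : ∃ i, ρ i x₀ ≠ 0 := by
    by_contra h
    push Not at h
    have hsum := ρ.sum_eq_one (Set.mem_univ x₀)
    simp [h] at hsum
  have hρpos : 0 < ρ i₀ x₀ := lt_of_le_of_ne (ρ.nonneg i₀ x₀) (Ne.symm hi₀)
  have hx₀src : x₀ ∈ (extChartAt I i₀).source := by
    rw [extChartAt_source]
    exact chartPartitionOfUnity_isSubordinate i₀ (subset_tsupport _ (Function.mem_support.2 hi₀))
  set y₀ := extChartAt I i₀ x₀ with hy₀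
  have hfy₀ : 0 < f i₀ y₀ := by
    rw [hf]
    dsimp only
    rw [hy₀, chartIntegrand_extChartAt hx₀src]
    refine mul_pos (mul_pos (abs_pos.2 ?_) hρpos) hx₀
    exact det_tangentCoordChange_ne_zero hx₀src (mem_extChartAt_source x₀)
  -- continuity of the integrand on the target, hence positivity of the `i₀`-th chart integral
  have hcont : ContinuousOn (f i₀) (extChartAt I i₀).target :=
    ((ho.continuousOn_chartSign i₀).mul
      ((map_continuous (ρ i₀)).comp_continuousOn (continuousOn_extChartAt_symm i₀))).mul
      (hα.continuousOn_inChart_apply_modelBasis i₀)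
  have hTpos : 0 < T i₀ := by
    have hae : 0 ≤ᵐ[μ.restrict (extChartAt I i₀).target] f i₀ :=
      (ae_restrict_iff' (measurableSet_extChartAt_target i₀)).2 (ae_of_all _ (hnonneg i₀))
    have hfi : IntegrableOn (f i₀) (extChartAt I i₀).target μ := integrableOn_chartIntegrand ho hα i₀
    rw [hT]
    dsimp only
    rw [setIntegral_pos_iff_support_of_nonneg_ae hae hfi]
    set U := (extChartAt I i₀).target ∩ f i₀ ⁻¹' Ioi 0 with hU
    have hUo : IsOpen U := hcont.isOpen_inter_preimage (isOpen_extChartAt_target i₀) isOpen_Ioi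
    have hy₀U : y₀ ∈ U := ⟨(extChartAt I i₀).map_source hx₀src, hfy₀⟩
    have hUsub : U ⊆ Function.support (f i₀) ∩ (extChartAt I i₀).target := fun y hy ↦
      ⟨Function.mem_support.2 (ne_of_gt hy.2), hy.1⟩
    exact lt_of_lt_of_le (hUo.measure_pos μ ⟨y₀, hy₀U⟩) (measure_mono hUsub)
  -- the finite sum is at least its `i₀`-th term
  have hS : (Function.support T).Finite := hasFiniteSupport_chartIntegral o α
  rw [hint, finsum_eq_sum _ hS]
  have hmem : i₀ ∈ hS.toFinset := by
    rw [Set.Finite.mem_toFinset]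
    exact Function.mem_support.2 (ne_of_gt hTpos)
  exact lt_of_lt_of_le hTpos (Finset.single_le_sum (fun i _ ↦ hTnonneg i) hmem)

end Positivity

/-! ### The complex orientation -/

section ComplexOrientation

variable {E : Type*} [NormedAddCommGroup E] [NormedSpace ℂ E] [FiniteDimensional ℂ E]
  {M : Type*} [TopologicalSpace M] [ChartedSpace E M] [IsManifold 𝓘(ℝ, E) ∞ M]
  [IsManifold 𝓘(ℂ, E) ω M]

omit [FiniteDimensional ℂ E] in
/-- **Tangent coordinate changes of a complex manifold have positive real determinant**
`det_ℝ = |det_ℂ|² > 0` (they are `ℂ`-linear, `tangentCoordChange_eq_restrictScalars`;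
`LinearMap.det_restrictScalars` with `Algebra.norm_complex_apply`; invertibility
`det_tangentCoordChange_ne_zero`). Huybrechts (2005), Cor. 1.2.3 (complex vector spaces, hence
complex manifolds, are canonically oriented). [cite: HuybrechtsCG2005, Cor. 1.2.3] -/
theorem det_tangentCoordChange_pos {p q x : M} (hp : x ∈ (extChartAt 𝓘(ℝ, E) p).source)
    (hq : x ∈ (extChartAt 𝓘(ℝ, E) q).source) :
    0 < LinearMap.det (tangentCoordChange 𝓘(ℝ, E) p q x : E →ₗ[ℝ] E) := by
  have hne := det_tangentCoordChange_ne_zero (I := 𝓘(ℝ, E)) hp hq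
  have hx : x ∈ (extChartAt 𝓘(ℂ, E) p).source ∩ (extChartAt 𝓘(ℂ, E) q).source := by
    simp only [extChartAt_source] at hp hq ⊢
    exact ⟨hp, hq⟩
  have hrs : (tangentCoordChange 𝓘(ℝ, E) p q x : E →ₗ[ℝ] E) =
      ((tangentCoordChange 𝓘(ℂ, E) p q x : E →L[ℂ] E) : E →ₗ[ℂ] E).restrictScalars ℝ := by
    rw [Literature.Geometry.Kaehler.tangentCoordChange_eq_restrictScalars hx]
    rfl
  rw [hrs] at hne ⊢
  rw [LinearMap.det_restrictScalars, Algebra.norm_complex_apply] at hne ⊢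
  exact lt_of_le_of_ne (Complex.normSq_nonneg _) (Ne.symm hne)

variable {n : ℕ} [Fact (finrank ℝ E = n)]

/-- **Chart signs of a constant orientation family on a complex manifold**: on the whole target
of every chart they equal the constant `sign (o₀(e₁, …, eₙ))`, the sign of (a representative of)
`o₀` on the reference frame — the coordinate changes having positive determinant.
[cite: HuybrechtsCG2005, Cor. 1.2.3] -/
theorem chartSign_const_eq (o₀ : Orientation ℝ E (Fin n)) (p : M) {y : E}
    (hy : y ∈ (extChartAt 𝓘(ℝ, E) p).target) :
    chartSign (I := 𝓘(ℝ, E)) (M := M) (fun _ ↦ o₀) p y = Real.sign (o₀.someVector (modelBasis E n)) := by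
  have hx : (extChartAt 𝓘(ℝ, E) p).symm y ∈ (extChartAt 𝓘(ℝ, E) p).source :=
    (extChartAt 𝓘(ℝ, E) p).map_target hy
  have hy' : y = extChartAt 𝓘(ℝ, E) p ((extChartAt 𝓘(ℝ, E) p).symm y) :=
    ((extChartAt 𝓘(ℝ, E) p).right_inv hy).symm
  rw [hy', chartSign_extChartAt _ hx, Real.sign_of_pos (det_tangentCoordChange_pos hx
    (mem_extChartAt_source _)), one_mul]
  rfl

/-- The sign of a non-zero top-degree alternating form on a basis is non-zero; in particular for
a representative `o₀.someVector` of an orientation. [folklore] -/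
theorem sign_someVector_modelBasis_ne_zero (o₀ : Orientation ℝ E (Fin n)) :
    Real.sign (o₀.someVector (modelBasis E n)) ≠ 0 := by
  intro h
  rw [Real.sign_eq_zero_iff] at h
  have hψ : (o₀.someVector : E [⋀^Fin n]→ₗ[ℝ] ℝ) = 0 := by
    rw [AlternatingMap.eq_smul_basis_det (modelBasis E n) o₀.someVector, h, zero_smul]
  exact Module.Ray.someVector_ne_zero o₀ hψ

/-- **Complex manifolds are oriented**: every constant orientation family `x ↦ o₀` on a complex
manifold is a continuous orientation in the sense of `IsContinuousOrientation` (its chart signs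
are the non-zero constant `sign (o₀(e))` on the chart targets, which are neighbourhoods of the
centres). Huybrechts (2005), Cor. 1.2.3 / Lemma 1.2.9; Lee (2013), Prop. 15.6.
[cite: HuybrechtsCG2005, Cor. 1.2.3] -/
theorem isContinuousOrientation_const (o₀ : Orientation ℝ E (Fin n)) :
    IsContinuousOrientation (I := 𝓘(ℝ, E)) (M := M) (fun _ ↦ o₀) := by
  intro x₀
  have hmem : (extChartAt 𝓘(ℝ, E) x₀).target ∈ 𝓝[range 𝓘(ℝ, E)] (extChartAt 𝓘(ℝ, E) x₀ x₀) :=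
    extChartAt_target_mem_nhdsWithin x₀
  filter_upwards [hmem] with y hy
  rw [chartSign_const_eq o₀ x₀ hy, chartSign_const_eq o₀ x₀ (mem_extChartAt_target x₀)]
  exact ⟨rfl, sign_someVector_modelBasis_ne_zero o₀⟩

end ComplexOrientation

end Literature.NumberTheory.Transcendental

end
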